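import Mathlib
import HarnessLib
import Literature.MathematicalPhysics.StatisticalMechanics.WeightDominatingH73All

/-!
# A parameter schedule for the dominating sequence (Adams–Buchholz–Kotecký–Müller, (7.41)–(7.45))

`h73_of_shellBoundsV` (`WeightDominatingH73All.lean`) reduces the hypothesis `h73` of
`WeightData.dominated_of_multipliers` to explicit side conditions on the parameters
`θ_k, δ'_k, μ, k₀` of [ABKM19] Lemma 7.5: the recursion `θ_{k+1} = θ_k − μ δ'_{k+1}` ((7.41) with
`δ'_k = θ_max δ_k`), `θ_k ∈ [−1, 1]`, `0 ≤ δ'_{k+1} ≤ (4λ)⁻¹`, `μ δ'_{k+1} ≤ 1 + θ_k`, `δ'_{k+1} = 0`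
for `k ≥ N`, the smallness `hsmall` (choice of `k₀`, from `exists_k0`) and the largeness `hlarge`
(choice of `μ`, (7.40)).  This file CONSTRUCTS such a schedule with, in addition, `θ̄ ≤ θ_k ≤ 2θ̄`
((7.41): "`θ_j ≥ θ̄`") and `δ'_k = δ₁ 4^{−k} > 0` for `1 ≤ k ≤ N` ((7.41): `δ_j = 4^{−j}δ`):

* `thetaSeq`, `deltaSeq` and their elementary properties;
* **`exists_schedule`** — existence of `(k₀, μ, δ₁)` satisfying every side condition of
  `h73_of_shellBoundsV` for the data `(L, d, n, ñ, s, c, C, lam, ω₀, θ̄, N)`.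

Everything is proved; no named fact.

## References
* S. Adams, S. Buchholz, R. Kotecký, S. Müller, arXiv:1910.13564, Lemma 7.5 (7.41)–(7.45), Lemma 7.3
  (7.35), (7.40) [AdamsBuchholzKoteckyMuller2019].
-/

noncomputable section

namespace Literature.MathematicalPhysics.StatisticalMechanics.GradientRG

open Finset Real

variable {d : ℕ}

/-- **`δ'_k = δ₁·4^{−k}` for `1 ≤ k ≤ N`, `0` otherwise** ((7.41)). [cite: AdamsBuchholzKoteckyMuller2019, Lemma 7.5 (7.41)] -/
def deltaSeq (δ₁ : ℝ) (N k : ℕ) : ℝ :=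
  if 1 ≤ k ∧ k ≤ N then δ₁ / 4 ^ k else 0

/-- **`θ_k = 2θ̄ − μ Σ_{j=1}^{k} δ'_j`** ((7.41)). [cite: AdamsBuchholzKoteckyMuller2019, Lemma 7.5 (7.41)] -/
def thetaSeq (θbar μ δ₁ : ℝ) (N k : ℕ) : ℝ :=
  2 * θbar - μ * ∑ j ∈ Icc 1 k, deltaSeq δ₁ N j

/-- The recursion `θ_{k+1} = θ_k − μ δ'_{k+1}`. [cite: AdamsBuchholzKoteckyMuller2019, Lemma 7.5 (7.41)] -/
theorem thetaSeq_succ (θbar μ δ₁ : ℝ) (N k : ℕ) :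
    thetaSeq θbar μ δ₁ N (k + 1) = thetaSeq θbar μ δ₁ N k - μ * deltaSeq δ₁ N (k + 1) := by
  unfold thetaSeq
  rw [Finset.sum_Icc_succ_top (by omega), mul_add]
  ring

/-- `δ'_k ≥ 0` for `δ₁ ≥ 0`. [cite: AdamsBuchholzKoteckyMuller2019, Lemma 7.5 (7.41)] -/
theorem deltaSeq_nonneg {δ₁ : ℝ} (h : 0 ≤ δ₁) (N k : ℕ) : 0 ≤ deltaSeq δ₁ N k := by
  unfold deltaSeq; split_ifs <;> positivity

/-- `δ'_k ≤ δ₁` (for `δ₁ ≥ 0`). [cite: AdamsBuchholzKoteckyMuller2019, Lemma 7.5 (7.41)] -/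
theorem deltaSeq_le {δ₁ : ℝ} (h : 0 ≤ δ₁) (N k : ℕ) : deltaSeq δ₁ N k ≤ δ₁ := by
  unfold deltaSeq
  split_ifs
  · exact div_le_self h (one_le_pow₀ (by norm_num))
  · exact h

/-- `δ'_{k+1} = 0` for `k ≥ N`. [cite: AdamsBuchholzKoteckyMuller2019, Lemma 7.5 (7.41)] -/
theorem deltaSeq_eq_zero {δ₁ : ℝ} {N k : ℕ} (hk : N ≤ k) : deltaSeq δ₁ N (k + 1) = 0 := by
  unfold deltaSeq; rw [if_neg (by omega)]

/-- `Σ_{j=1}^{k} δ'_j ≤ δ₁/3` (geometric series). [cite: AdamsBuchholzKoteckyMuller2019, Lemma 7.5 (7.41)] -/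
theorem sum_deltaSeq_le {δ₁ : ℝ} (h : 0 ≤ δ₁) (N k : ℕ) : ∑ j ∈ Icc 1 k, deltaSeq δ₁ N j ≤ δ₁ / 3 := by
  have h1 : ∑ j ∈ Icc 1 k, deltaSeq δ₁ N j ≤ ∑ j ∈ Icc 1 k, δ₁ * (1 / 4) ^ j := by
    refine sum_le_sum fun j _ => ?_
    unfold deltaSeq
    split_ifs
    · rw [one_div, inv_pow, div_eq_mul_inv]
    · positivity
  have h2 : ∑ j ∈ Icc 1 k, (1 / 4 : ℝ) ^ j ≤ 1 / 3 := by
    have hIcc : Icc 1 k = Ico 1 (k + 1) := by ext j; simp only [mem_Icc, mem_Ico]; omega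
    rw [hIcc]
    refine (geom_sum_Ico_le_of_lt_one (by norm_num) (by norm_num)).trans ?_
    norm_num
  rw [← mul_sum] at h1
  calc ∑ j ∈ Icc 1 k, deltaSeq δ₁ N j ≤ δ₁ * ∑ j ∈ Icc 1 k, (1 / 4 : ℝ) ^ j := h1
    _ ≤ δ₁ * (1 / 3) := mul_le_mul_of_nonneg_left h2 h
    _ = δ₁ / 3 := by ring

/-- **`θ̄ ≤ θ_k ≤ 2θ̄`** when `0 ≤ μδ₁ ≤ 3θ̄`. [cite: AdamsBuchholzKoteckyMuller2019, Lemma 7.5 (7.41)] -/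
theorem thetaSeq_mem {θbar μ δ₁ : ℝ} (hδ : 0 ≤ δ₁) (hμ : 0 ≤ μ) (hμδ : μ * δ₁ ≤ 3 * θbar) (N k : ℕ) :
    θbar ≤ thetaSeq θbar μ δ₁ N k ∧ thetaSeq θbar μ δ₁ N k ≤ 2 * θbar := by
  unfold thetaSeq
  have hs0 : 0 ≤ ∑ j ∈ Icc 1 k, deltaSeq δ₁ N j := sum_nonneg fun j _ => deltaSeq_nonneg hδ N j
  have hs1 := sum_deltaSeq_le hδ N k
  constructor
  · have : μ * ∑ j ∈ Icc 1 k, deltaSeq δ₁ N j ≤ μ * (δ₁ / 3) := mul_le_mul_of_nonneg_left hs1 hμ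
    nlinarith
  · nlinarith [mul_nonneg hμ hs0]

/-- **Existence of a parameter schedule** satisfying all side conditions of `h73_of_shellBoundsV`
([ABKM19] (7.31), (7.40), (7.41), (7.44)): data `L > 1`, `d ≥ 1`, `2(M−1) < d−1+n` (orders in `s`
bounded by `M`), `c > 0`, `C ≥ 0`, `lam > 0`, `ω₀ > 0`, `0 < θ̄ ≤ 1/2`.
[cite: AdamsBuchholzKoteckyMuller2019, Lemma 7.5 (v)] -/
theorem exists_schedule {s : Finset (Fin d → ℕ)} {Mord : ℕ} (hsM : ∀ α ∈ s, ∑ i, α i ≤ Mord)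
    {L : ℝ} (hL : 1 < L) (hd : 1 ≤ d) {n ñ : ℕ} (hn : 2 * (Mord - 1) < d - 1 + n) {lam c C ω₀ θbar : ℝ}
    (hlam : 0 < lam) (hc : 0 < c) (hC : 0 ≤ C) (hω : 0 < ω₀) (hθ0 : 0 < θbar) (hθ1 : θbar ≤ 1 / 2)
    (N : ℕ) :
    ∃ (k₀ : ℕ) (μ δ₁ : ℝ), 0 ≤ μ ∧ 0 < δ₁ ∧
      (∀ k, θbar ≤ thetaSeq θbar μ δ₁ N k ∧ thetaSeq θbar μ δ₁ N k ≤ 2 * θbar) ∧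
      (∀ k, 0 ≤ 1 + thetaSeq θbar μ δ₁ N k) ∧ (∀ k, thetaSeq θbar μ δ₁ N k ≤ 1) ∧
      (∀ k, thetaSeq θbar μ δ₁ N (k + 1) = thetaSeq θbar μ δ₁ N k - μ * deltaSeq δ₁ N (k + 1)) ∧
      (∀ k, 0 ≤ deltaSeq δ₁ N (k + 1)) ∧ (∀ k, deltaSeq δ₁ N (k + 1) ≤ (4 * lam)⁻¹) ∧
      (∀ k, μ * deltaSeq δ₁ N (k + 1) ≤ 1 + thetaSeq θbar μ δ₁ N k) ∧
      (∀ k, N ≤ k → deltaSeq δ₁ N (k + 1) = 0) ∧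
      (∀ e : ℕ, k₀ + 2 ≤ e →
        4 * (C * L ^ (2 * (d + ñ) + 1)) * (shellConst s L e * (d * π ^ 2)) ≤
          lam * (L ^ (d - 1 + n)) ^ (e + 1)) ∧
      (∀ k, shellConst s L (k₀ + 1) * (d * π ^ 2) *
          ((1 + thetaSeq θbar μ δ₁ N k) * (ω₀ * (4 / π ^ 2))⁻¹ + lam * (4 / π ^ 2)⁻¹) ^ 2 ≤
        μ * ((c / L ^ (2 * (d + ñ) + 1)) / (L ^ 2 * (L ^ (d - 1 + n)) ^ (k₀ + 2)))) := by
  obtain ⟨k₀, hk₀⟩ := exists_k0 hsM hL hd (ñ := ñ) hn hlam hC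
  have hL0 : 0 < L := by linarith
  -- the constants of `hlarge`
  set ω₁ : ℝ := (c / L ^ (2 * (d + ñ) + 1)) / (L ^ 2 * (L ^ (d - 1 + n)) ^ (k₀ + 2)) with hω₁
  have hω₁0 : 0 < ω₁ := by positivity
  set K : ℝ := shellConst s L (k₀ + 1) * (d * π ^ 2) with hK
  have hK0 : 0 ≤ K := mul_nonneg (shellConst_nonneg s hL0.le _) (by positivity)
  set a : ℝ := (ω₀ * (4 / π ^ 2))⁻¹ with ha
  set b : ℝ := lam * (4 / π ^ 2)⁻¹ with hb
  have ha0 : 0 ≤ a := by positivity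
  have hb0 : 0 ≤ b := by positivity
  set μ : ℝ := K * (2 * a + b) ^ 2 / ω₁ with hμ
  have hμ0 : 0 ≤ μ := by positivity
  set δ₁ : ℝ := min (4 * lam)⁻¹ (θbar / (μ + 1)) with hδ₁
  have hδ₁0 : 0 < δ₁ := lt_min (by positivity) (by positivity)
  have hδ₁lam : δ₁ ≤ (4 * lam)⁻¹ := min_le_left _ _
  have hμδ₁ : μ * δ₁ ≤ θbar := by
    have h1 : δ₁ ≤ θbar / (μ + 1) := min_le_right _ _
    have h2 : μ * δ₁ ≤ μ * (θbar / (μ + 1)) := mul_le_mul_of_nonneg_left h1 hμ0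
    have h3 : μ * (θbar / (μ + 1)) ≤ θbar := by
      rw [mul_div_assoc', div_le_iff₀ (by positivity)]; nlinarith
    linarith
  have hθmem : ∀ k, θbar ≤ thetaSeq θbar μ δ₁ N k ∧ thetaSeq θbar μ δ₁ N k ≤ 2 * θbar :=
    fun k => thetaSeq_mem hδ₁0.le hμ0 (by linarith) N k
  refine ⟨k₀, μ, δ₁, hμ0, hδ₁0, hθmem, fun k => by linarith [(hθmem k).1],
    fun k => by linarith [(hθmem k).2], fun k => thetaSeq_succ θbar μ δ₁ N k,
    fun k => deltaSeq_nonneg hδ₁0.le N (k + 1),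
    fun k => (deltaSeq_le hδ₁0.le N (k + 1)).trans hδ₁lam, fun k => ?_,
    fun k hk => deltaSeq_eq_zero hk, hk₀, fun k => ?_⟩
  · -- `μ δ'_{k+1} ≤ μ δ₁ ≤ θ̄ ≤ 1 + θ_k`
    have h1 : μ * deltaSeq δ₁ N (k + 1) ≤ μ * δ₁ :=
      mul_le_mul_of_nonneg_left (deltaSeq_le hδ₁0.le N (k + 1)) hμ0
    linarith [(hθmem k).1]
  · -- `hlarge`: `K ((1+θ_k) a + b)² ≤ K (2a + b)² = μ ω₁`
    have hθk := (hθmem k).2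
    have h1 : (1 + thetaSeq θbar μ δ₁ N k) * a + b ≤ 2 * a + b := by nlinarith
    have h0 : 0 ≤ (1 + thetaSeq θbar μ δ₁ N k) * a + b :=
      add_nonneg (mul_nonneg (by linarith [(hθmem k).1]) ha0) hb0
    have h2 : ((1 + thetaSeq θbar μ δ₁ N k) * a + b) ^ 2 ≤ (2 * a + b) ^ 2 := pow_le_pow_left₀ h0 h1 2
    calc K * ((1 + thetaSeq θbar μ δ₁ N k) * a + b) ^ 2 ≤ K * (2 * a + b) ^ 2 :=
          mul_le_mul_of_nonneg_left h2 hK0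
      _ = μ * ω₁ := by rw [hμ]; field_simp

end Literature.MathematicalPhysics.StatisticalMechanics.GradientRG

end
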